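import Summits.HodgeConjecture.HodgeConjecture.Theorems.R90S6EtaOnePartnerOnGenerators   -- ★ W10-h (p02): brings ★ η̂₁ (W10-a, p06), ★ b (W7-b, p09), ★ (G.·)/(B.·) (W10-c, p06), the U(2) Satake estate
import Summits.HodgeConjecture.HodgeConjecture.Theorems.R90S6SatakeGraphPartnerHom       -- ★ W3 ξ̂_H `satakeGraphPartnerAlgHom` (p03) with its SIGNED graph
import HarnessLib

/-!
# R90 · S6 «Ch. 14.1–14.5 stable TF» — WAVE 10 card W10-i: THE SIGN INVOLUTION `τ` OF `ℋ(U(J₀,2)(E_w), K₀)` (`λ_{(z,1)}(τ f) = λ_{(−z,1)}(f)`) AND THE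
# FACTORISATION `η̂₁ = τ ∘ ξ̂_H ∘ ψ̂_G` (`Theorems/R90S6EtaOneFactorsThroughSign.lean`; DAG r5 rows E1.4.4.1.2 ∕ E1.4.4.3.x)

Cell `hodgecm-mathlib`, crux H413 (`stmt-HodgeConjecture-24833`), route of record `HCCMUnconditional`; programme R90-TF, section S6 (base `R90-C14`),
seat R90-C14-p02 (g2); S6 dealer R90-C14-plan (g2) CARD W10-i (R90 bus 2026-09-05T01:00:45Z, RULING R2 00:58Z).  Lane `--supports stmt-HodgeConjecture-24833
--as helper`.  ONE API MODULE (definition lane: `signInvolution`, `signInvolutionAlgHom` are `def`s, C5-safe total functions; + graph ∕ uniqueness ∕ hom laws ∕ the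
four heads); no `instance`, no `notation`, no named fact, no `sorry`; imports = ★ Theorems + HarnessLib (no `Cruxes` import).

WHY (dealer R2).  The tree holds THREE graphs at an inert unramified place `w ∣ v`:
`ψ̂_G = b` (★ `bcGraphPartnerAlgHom`, p09): `λ^{GL₃}_{(z,1,z⁻¹)}(φ) = λ^{U(3)}_{(z,1,1)}(b φ)`;  `ξ̂_H` (★ `satakeGraphPartnerAlgHom`, p03):
`λ^{U(2)}_{(z,1)}(ξ̂_H f) = λ^{U(3)}_{(−z,1,1)}(f)` (SIGNED — print p. 55 «`ξ̂_H(f)^∧(z) = f^∧(−z)`», `μ_w = χ_{−1}`);  `η̂₁` (★ `etaOneGraphPartnerAlgHom`, p06):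
`λ^{GL₃}_{(z,1,z⁻¹)}(φ) = λ^{U(2)}_{(z,1)}(η̂₁ φ)` (UNSIGNED — §4.7 p. 48 case `a ≢ b`: `η₁|_{W_E} = 1`).  Hence `η̂₁ ≠ ξ̂_H ∘ ψ̂_G` on spherical algebras;
they differ by the INVOLUTION `τ` of `ℋ(U(J₀,2)(E_w), K₀) = ℂ[T₁ᵁ]` with graph `λ_{(z,1)}(τ f) = λ_{(−z,1)}(f)` (`T₁ᵁ ↦ −T₁ᵁ`): **`η̂₁ = τ ∘ ξ̂_H ∘ ψ̂_G`**.  So the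
Cartan-basis expansion of `η̂₁` (E1.4.4.3) = (p06's `b`-recursion W10-f) ∘ (p03's `ξ̂_H` on the basis, H1) ∘ (`τ` on the `φ′`-basis) — no fourth Hall computation.
KILL-CHECK on `T₁` (closes): `b T₁ = Q•T₁^{U(3)} + Q•1` (★ (B.1)), `ξ̂_H(T₁^{U(3)}) = −T₁ᵁ`, `τ(−T₁ᵁ) = T₁ᵁ` ⇒ `τ ξ̂_H b T₁ = Q•T₁ᵁ + Q•1 = η̂₁ T₁` (★ (N.1)); in raw
letters `φ′₁ = √Q T₁ᵁ + (√Q − 1)•1`: `τ(φ′₁) = −φ′₁ + 2(√Q − 1)•1` and `η̂₁ T₁ = √Q•φ′₁ + √Q•1` (★ (N.1′)) ✓.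

(τ.0) CENSUS: `ℋ(U(J₀,2)(E_w), K₀) = ℂ[T₁ᵁ]` with `𝒮_w(T₁ᵁ) = x^{(1,−1)} + x^{(−1,1)}` is ★ (`exists_generator_unitaryHeckeAlgebraAdic_two`: generation; ★ `satakeGraph_partner_unique`:
the `λ_{(z,1)}` separate, so `P ↦ P(T₁ᵁ)` is injective — FREE); no ★ universal-property constructor is needed: `τ` is built GRAPH-FIRST exactly like the ★ partner maps
(`Classical.choose` of `exists_sign_partner` — witness `P(−X)(T₁ᵁ)` — unique by ★ `satakeGraph_partner_unique`), which makes every law a one-line graph check.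

* §1 `exists_sign_partner` (`∀ f ∃ g, λ_{(z,1)} g = λ_{(−z,1)} f`), `def signInvolution`, `_graph`, `eq_signInvolution_of_graph`, hom laws, `def signInvolutionAlgHom` (+ `_apply`,
  `graph_signInvolutionAlgHom`, `eq_signInvolutionAlgHom_of_graph`);
* §2 (I.1) **`signInvolutionAlgHom_signInvolutionAlgHom`** (`τ (τ f) = f`), **`signInvolutionAlgHom_comp_self`** (`τ ∘ τ = id`), **`signInvolutionAlgHom_generator`** (`τ T₁ᵁ = −T₁ᵁ`
  for any `T₁ᵁ` with the odd Satake transform);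
* §3 (I.2) **`etaOneGraphPartnerAlgHom_eq_signInvolution_comp`**: `η̂₁ = τ.comp (ξ̂_H.comp ψ̂_G)` (★ `eq_etaOneGraphPartnerAlgHom_of_graph` + the three graphs), and pointwise;
* §4 (I.3, `k = 1`) **`signInvolutionAlgHom_basic`**: `τ φ′₁ = −φ′₁ + 2(√Q − 1)•1` for the basic operator `φ′₁ = 1_{K₀ t K₀}` (★ `heckeEigencharacter_doubleCosetOperator_basic_two`).
NOT here: (I.3) for general `k` (`τ(φ′_k)` in the `φ′`-basis needs p03's F2′-U2 closed form ★ `R90S6MacdonaldClosedFormU2`; sequel file).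
HONEST LABEL: local spherical Hecke bookkeeping; proves no orbital-integral identity and no printed global statement; count-neutral until E1.4.4.3.x consumes the
factorisation.  HC_CM is proved only modulo the 7 printed citations (2 remaining named inputs: hLiu418 = stmt-HodgeConjecture-24832, h413 = stmt-HodgeConjecture-24833) until
rung 0 closes; REL ≠ ★ ≠ BUILT.

## References
* [Rogawski1990] J. D. Rogawski, *Automorphic Representations of Unitary Groups in Three Variables*, Ann. of Math. Stud. 123 (1990), §4.7 p. 48 (`η₁`, `ξ_H`: where `μ`
  enters), §4.9 p. 55 («`ξ̂_H(f)^∧(z) = f^∧(−z)`»), §4.10 Prop. 4.10.1, 4.10.2 pp. 57–58 (`ψ̂_G`, `η̂₁`).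
* [CartierCorvallis1979] P. Cartier, *Representations of 𝔭-adic groups: a survey*, PSPM 33.1 (1979), §IV (4.2)–(4.4), Thm. 4.1, Cor. 4.2.
-/

set_option autoImplicit false
-- the mandated namespace repeats the single-problem summit's segment (`HodgeConjecture.HodgeConjecture`)
set_option linter.dupNamespace false

noncomputable section

open NumberField IsDedekindDomain Polynomial
open Literature.NumberTheory.Automorphic Literature.NumberTheory.Automorphic.HermitianLattice Literature.NumberTheory.Automorphic.UnitaryGroup
open Literature.NumberTheory.Automorphic.CartanUnique
open scoped MatrixGroups
open ValuativeRel

namespace Summit.HodgeConjecture.HodgeConjecture.R90.S6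

universe u

section Sign

variable {F E : Type} [Field F] [NumberField F] [Field E] [NumberField E] [Algebra F E] [Algebra.IsQuadraticExtension F E]
  (c : E ≃ₐ[F] E) (hc1 : c ≠ 1) (v : HeightOneSpectrum (𝓞 F)) (w : PlacesOver E v) (hw : c • w.1 = w.1)
  (hv : Algebra.IsUnramifiedIn (𝓞 E) v.asIdeal)

/-! ## §1 The sign partner and the involution `τ` -/

/-- **Existence of the sign partner**: for every `f ∈ ℋ(U(J₀,2)(E_w), K₀)` there is `g` with `λ_{(z,1)}(g) = λ_{(−z,1)}(f)` for all `z ∈ ℂˣ` — write `f = P(T₁ᵁ)`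
(★ `exists_generator_unitaryHeckeAlgebraAdic_two`), take `g = P(−X)(T₁ᵁ)`: `λ_{(z,1)}(g) = P(−(z + z⁻¹)) = P((−z) + (−z)⁻¹) = λ_{(−z,1)}(f)`
(★ `unitaryHeckeEigencharacterAdic_two_aeval`). [cite: CartierCorvallis1979, §IV Thm. 4.1] [cite: Rogawski1990, §4.9 p. 55] -/
theorem exists_sign_partner
    (f : heckeAlgebra ℂ ↥(unitaryGroupOfForm (galAdicCompletionMap (L := E) c hw) ((StdForm.antidiagonal 2).over (w.1.adicCompletion E)))
      (unitaryInt (galAdicCompletionMap (L := E) c hw) ((StdForm.antidiagonal 2).over (w.1.adicCompletion E)))) :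
    ∃ g : heckeAlgebra ℂ ↥(unitaryGroupOfForm (galAdicCompletionMap (L := E) c hw) ((StdForm.antidiagonal 2).over (w.1.adicCompletion E)))
        (unitaryInt (galAdicCompletionMap (L := E) c hw) ((StdForm.antidiagonal 2).over (w.1.adicCompletion E))),
      ∀ z : ℂˣ, unitaryHeckeEigencharacterAdic c hc1 v w hw hv ![z, 1] g = unitaryHeckeEigencharacterAdic c hc1 v w hw hv ![-z, 1] f := by
  obtain ⟨T₁, hT₁, hgen⟩ := exists_generator_unitaryHeckeAlgebraAdic_two c hc1 v w hw hv
  obtain ⟨P, rfl⟩ := hgen f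
  refine ⟨aeval T₁ (P.comp (-X)), fun z => ?_⟩
  refine (unitaryHeckeEigencharacterAdic_two_aeval c hc1 v w hw hv hT₁ (P.comp (-X)) z).trans
    (Eq.trans ?_ (unitaryHeckeEigencharacterAdic_two_aeval c hc1 v w hw hv hT₁ P (-z)).symm)
  rw [eval_comp, eval_neg, eval_X, Units.val_neg, inv_neg, neg_add]

/-- **The SIGN INVOLUTION `τ`** of `ℋ(U(J₀,2)(E_w), K₀)`: THE element `τ f` with `λ_{(z,1)}(τ f) = λ_{(−z,1)}(f)` for all `z ∈ ℂˣ` (exists by `exists_sign_partner`, unique by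
★ `satakeGraph_partner_unique`; chosen with `Classical.choose`).  On `ℂ[T₁ᵁ]`: `P(T₁ᵁ) ↦ P(−T₁ᵁ)`.  A FUNCTION (C5-safe). [cite: Rogawski1990, §4.9 p. 55] -/
noncomputable def signInvolution
    (f : heckeAlgebra ℂ ↥(unitaryGroupOfForm (galAdicCompletionMap (L := E) c hw) ((StdForm.antidiagonal 2).over (w.1.adicCompletion E)))
      (unitaryInt (galAdicCompletionMap (L := E) c hw) ((StdForm.antidiagonal 2).over (w.1.adicCompletion E)))) :
    heckeAlgebra ℂ ↥(unitaryGroupOfForm (galAdicCompletionMap (L := E) c hw) ((StdForm.antidiagonal 2).over (w.1.adicCompletion E)))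
      (unitaryInt (galAdicCompletionMap (L := E) c hw) ((StdForm.antidiagonal 2).over (w.1.adicCompletion E))) :=
  (exists_sign_partner c hc1 v w hw hv f).choose

/-- **The graph of `τ`**: `λ_{(z,1)}(τ f) = λ_{(−z,1)}(f)`. [cite: Rogawski1990, §4.9 p. 55] -/
theorem signInvolution_graph
    (f : heckeAlgebra ℂ ↥(unitaryGroupOfForm (galAdicCompletionMap (L := E) c hw) ((StdForm.antidiagonal 2).over (w.1.adicCompletion E)))
      (unitaryInt (galAdicCompletionMap (L := E) c hw) ((StdForm.antidiagonal 2).over (w.1.adicCompletion E)))) (z : ℂˣ) :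
    unitaryHeckeEigencharacterAdic c hc1 v w hw hv ![z, 1] (signInvolution c hc1 v w hw hv f) =
      unitaryHeckeEigencharacterAdic c hc1 v w hw hv ![-z, 1] f :=
  (exists_sign_partner c hc1 v w hw hv f).choose_spec z

/-- **Characterisation**: any `g` in sign-graph position with `f` IS `τ f` (★ `satakeGraph_partner_unique`). [cite: CartierCorvallis1979, §IV Cor. 4.2] -/
theorem eq_signInvolution_of_graph
    (f g : heckeAlgebra ℂ ↥(unitaryGroupOfForm (galAdicCompletionMap (L := E) c hw) ((StdForm.antidiagonal 2).over (w.1.adicCompletion E)))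
      (unitaryInt (galAdicCompletionMap (L := E) c hw) ((StdForm.antidiagonal 2).over (w.1.adicCompletion E))))
    (h : ∀ z : ℂˣ, unitaryHeckeEigencharacterAdic c hc1 v w hw hv ![z, 1] g = unitaryHeckeEigencharacterAdic c hc1 v w hw hv ![-z, 1] f) :
    g = signInvolution c hc1 v w hw hv f :=
  satakeGraph_partner_unique c hc1 v w hw hv g _ fun z => (h z).trans (signInvolution_graph c hc1 v w hw hv f z).symm

/-- `τ 1 = 1`. [cite: Rogawski1990, §4.9 p. 55] -/
theorem signInvolution_one : signInvolution c hc1 v w hw hv 1 = 1 :=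
  (eq_signInvolution_of_graph c hc1 v w hw hv 1 1 fun _ => (map_one _).trans (map_one _).symm).symm

/-- `τ 0 = 0`. [cite: Rogawski1990, §4.9 p. 55] -/
theorem signInvolution_zero : signInvolution c hc1 v w hw hv 0 = 0 :=
  (eq_signInvolution_of_graph c hc1 v w hw hv 0 0 fun _ => (map_zero _).trans (map_zero _).symm).symm

/-- `τ (f g) = τ f · τ g`. [cite: Rogawski1990, §4.9 p. 55] -/
theorem signInvolution_mul
    (f g : heckeAlgebra ℂ ↥(unitaryGroupOfForm (galAdicCompletionMap (L := E) c hw) ((StdForm.antidiagonal 2).over (w.1.adicCompletion E)))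
      (unitaryInt (galAdicCompletionMap (L := E) c hw) ((StdForm.antidiagonal 2).over (w.1.adicCompletion E)))) :
    signInvolution c hc1 v w hw hv (f * g) = signInvolution c hc1 v w hw hv f * signInvolution c hc1 v w hw hv g :=
  (eq_signInvolution_of_graph c hc1 v w hw hv (f * g) _ fun z => (map_mul _ _ _).trans
    ((congrArg₂ (· * ·) (signInvolution_graph c hc1 v w hw hv f z) (signInvolution_graph c hc1 v w hw hv g z)).trans (map_mul _ _ _).symm)).symm

/-- `τ (f + g) = τ f + τ g`. [cite: Rogawski1990, §4.9 p. 55] -/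
theorem signInvolution_add
    (f g : heckeAlgebra ℂ ↥(unitaryGroupOfForm (galAdicCompletionMap (L := E) c hw) ((StdForm.antidiagonal 2).over (w.1.adicCompletion E)))
      (unitaryInt (galAdicCompletionMap (L := E) c hw) ((StdForm.antidiagonal 2).over (w.1.adicCompletion E)))) :
    signInvolution c hc1 v w hw hv (f + g) = signInvolution c hc1 v w hw hv f + signInvolution c hc1 v w hw hv g := by
  refine (eq_signInvolution_of_graph c hc1 v w hw hv (f + g) _ fun z => ?_).symm
  have h₁ := (unitaryHeckeEigencharacterAdic c hc1 v w hw hv ![z, 1]).toRingHom.map_add (signInvolution c hc1 v w hw hv f) (signInvolution c hc1 v w hw hv g)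
  have h₂ := (unitaryHeckeEigencharacterAdic c hc1 v w hw hv ![-z, 1]).toRingHom.map_add f g
  exact h₁.trans ((congrArg₂ (· + ·) (signInvolution_graph c hc1 v w hw hv f z) (signInvolution_graph c hc1 v w hw hv g z)).trans h₂.symm)

/-- `τ (r • f) = r • τ f`. [cite: Rogawski1990, §4.9 p. 55] -/
theorem signInvolution_smul (r : ℂ)
    (f : heckeAlgebra ℂ ↥(unitaryGroupOfForm (galAdicCompletionMap (L := E) c hw) ((StdForm.antidiagonal 2).over (w.1.adicCompletion E)))
      (unitaryInt (galAdicCompletionMap (L := E) c hw) ((StdForm.antidiagonal 2).over (w.1.adicCompletion E)))) :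
    signInvolution c hc1 v w hw hv (r • f) = r • signInvolution c hc1 v w hw hv f := by
  refine (eq_signInvolution_of_graph c hc1 v w hw hv (r • f) _ fun z => ?_).symm
  have h₁ := (unitaryHeckeEigencharacterAdic c hc1 v w hw hv ![z, 1]).toLinearMap.map_smul r (signInvolution c hc1 v w hw hv f)
  have h₂ := (unitaryHeckeEigencharacterAdic c hc1 v w hw hv ![-z, 1]).toLinearMap.map_smul r f
  exact h₁.trans ((congrArg (r • ·) (signInvolution_graph c hc1 v w hw hv f z)).trans h₂.symm)

/-- `τ (r · 1) = r · 1`. [cite: Rogawski1990, §4.9 p. 55] -/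
theorem signInvolution_algebraMap (r : ℂ) : signInvolution c hc1 v w hw hv (algebraMap ℂ _ r) = algebraMap ℂ _ r :=
  (eq_signInvolution_of_graph c hc1 v w hw hv (algebraMap ℂ _ r) (algebraMap ℂ _ r) fun _ =>
    (AlgHom.commutes _ _).trans (AlgHom.commutes _ _).symm).symm

/-- **`τ` as a `ℂ`-algebra homomorphism `ℋ(U(J₀,2)(E_w), K₀) →ₐ[ℂ] ℋ(U(J₀,2)(E_w), K₀)`.** [cite: Rogawski1990, §4.9 p. 55] [cite: CartierCorvallis1979, §IV Thm. 4.1] -/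
noncomputable def signInvolutionAlgHom :
    heckeAlgebra ℂ ↥(unitaryGroupOfForm (galAdicCompletionMap (L := E) c hw) ((StdForm.antidiagonal 2).over (w.1.adicCompletion E)))
        (unitaryInt (galAdicCompletionMap (L := E) c hw) ((StdForm.antidiagonal 2).over (w.1.adicCompletion E))) →ₐ[ℂ]
      heckeAlgebra ℂ ↥(unitaryGroupOfForm (galAdicCompletionMap (L := E) c hw) ((StdForm.antidiagonal 2).over (w.1.adicCompletion E)))
        (unitaryInt (galAdicCompletionMap (L := E) c hw) ((StdForm.antidiagonal 2).over (w.1.adicCompletion E))) where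
  toFun := signInvolution c hc1 v w hw hv
  map_one' := signInvolution_one c hc1 v w hw hv
  map_mul' := signInvolution_mul c hc1 v w hw hv
  map_zero' := signInvolution_zero c hc1 v w hw hv
  map_add' := signInvolution_add c hc1 v w hw hv
  commutes' := signInvolution_algebraMap c hc1 v w hw hv

/-- `τ f = signInvolution f` (definitional). [folklore] -/
theorem signInvolutionAlgHom_apply
    (f : heckeAlgebra ℂ ↥(unitaryGroupOfForm (galAdicCompletionMap (L := E) c hw) ((StdForm.antidiagonal 2).over (w.1.adicCompletion E)))
      (unitaryInt (galAdicCompletionMap (L := E) c hw) ((StdForm.antidiagonal 2).over (w.1.adicCompletion E)))) :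
    signInvolutionAlgHom c hc1 v w hw hv f = signInvolution c hc1 v w hw hv f :=
  rfl

/-- **(I.1) The graph law for the hom**: `λ_{(z,1)}(τ f) = λ_{(−z,1)}(f)`. [cite: Rogawski1990, §4.9 p. 55] -/
theorem graph_signInvolutionAlgHom
    (f : heckeAlgebra ℂ ↥(unitaryGroupOfForm (galAdicCompletionMap (L := E) c hw) ((StdForm.antidiagonal 2).over (w.1.adicCompletion E)))
      (unitaryInt (galAdicCompletionMap (L := E) c hw) ((StdForm.antidiagonal 2).over (w.1.adicCompletion E)))) (z : ℂˣ) :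
    unitaryHeckeEigencharacterAdic c hc1 v w hw hv ![z, 1] (signInvolutionAlgHom c hc1 v w hw hv f) =
      unitaryHeckeEigencharacterAdic c hc1 v w hw hv ![-z, 1] f :=
  signInvolution_graph c hc1 v w hw hv f z

/-- Uniqueness in hom form. [cite: CartierCorvallis1979, §IV Cor. 4.2] -/
theorem eq_signInvolutionAlgHom_of_graph
    (f g : heckeAlgebra ℂ ↥(unitaryGroupOfForm (galAdicCompletionMap (L := E) c hw) ((StdForm.antidiagonal 2).over (w.1.adicCompletion E)))
      (unitaryInt (galAdicCompletionMap (L := E) c hw) ((StdForm.antidiagonal 2).over (w.1.adicCompletion E))))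
    (h : ∀ z : ℂˣ, unitaryHeckeEigencharacterAdic c hc1 v w hw hv ![z, 1] g = unitaryHeckeEigencharacterAdic c hc1 v w hw hv ![-z, 1] f) :
    g = signInvolutionAlgHom c hc1 v w hw hv f :=
  eq_signInvolution_of_graph c hc1 v w hw hv f g h

/-! ## §2 (I.1) `τ` is an involution; `τ T₁ᵁ = −T₁ᵁ` -/

/-- **`τ (τ f) = f`**: `λ_{(z,1)}(τ τ f) = λ_{(−z,1)}(τ f) = λ_{(z,1)}(f)` and uniqueness. [cite: Rogawski1990, §4.9 p. 55] -/
theorem signInvolutionAlgHom_signInvolutionAlgHom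
    (f : heckeAlgebra ℂ ↥(unitaryGroupOfForm (galAdicCompletionMap (L := E) c hw) ((StdForm.antidiagonal 2).over (w.1.adicCompletion E)))
      (unitaryInt (galAdicCompletionMap (L := E) c hw) ((StdForm.antidiagonal 2).over (w.1.adicCompletion E)))) :
    signInvolutionAlgHom c hc1 v w hw hv (signInvolutionAlgHom c hc1 v w hw hv f) = f := by
  refine satakeGraph_partner_unique c hc1 v w hw hv _ _ fun z => ?_
  rw [graph_signInvolutionAlgHom, graph_signInvolutionAlgHom, neg_neg]

/-- **`τ ∘ τ = id`**. [cite: Rogawski1990, §4.9 p. 55] -/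
theorem signInvolutionAlgHom_comp_self :
    (signInvolutionAlgHom c hc1 v w hw hv).comp (signInvolutionAlgHom c hc1 v w hw hv) = AlgHom.id ℂ _ :=
  AlgHom.ext fun f => signInvolutionAlgHom_signInvolutionAlgHom c hc1 v w hw hv f

/-- **`τ T₁ᵁ = −T₁ᵁ`** (stated as `(−1 : ℂ) • T₁ᵁ`: scalar action only — `Neg`∕`Ring`-path lemmas on this carrier are heartbeat-expensive; `neg_one_smul` converts)
for any generator `T₁ᵁ` with the ODD Satake transform `𝒮_w(T₁ᵁ) = x^{(1,−1)} + x^{(−1,1)}` (`λ_{(z,1)}(T₁ᵁ) = z + z⁻¹`):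
`λ_{(z,1)}(−T₁ᵁ) = −(z + z⁻¹) = (−z) + (−z)⁻¹ = λ_{(−z,1)}(T₁ᵁ)`. [cite: Rogawski1990, §4.9 p. 55] [cite: CartierCorvallis1979, §IV (4.2)] -/
theorem signInvolutionAlgHom_generator
    {T₁ : heckeAlgebra ℂ ↥(unitaryGroupOfForm (galAdicCompletionMap (L := E) c hw) ((StdForm.antidiagonal 2).over (w.1.adicCompletion E)))
      (unitaryInt (galAdicCompletionMap (L := E) c hw) ((StdForm.antidiagonal 2).over (w.1.adicCompletion E)))}
    (hT₁ : unitarySatakeTransformAdic c hc1 v w hw hv T₁ =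
      AddMonoidAlgebra.single (fun i : Fin 2 => (1 : ℤ) * (1 - 2 * (i : ℕ))) (1 : ℂ) +
        AddMonoidAlgebra.single (fun i : Fin 2 => (-1 : ℤ) * (1 - 2 * (i : ℕ))) 1) :
    signInvolutionAlgHom c hc1 v w hw hv T₁ = (-1 : ℂ) • T₁ := by
  refine (eq_signInvolutionAlgHom_of_graph c hc1 v w hw hv T₁ ((-1 : ℂ) • T₁) fun z => ?_).symm
  have hz : unitaryHeckeEigencharacterAdic c hc1 v w hw hv ![z, 1] T₁ = (z : ℂ) + (z : ℂ)⁻¹ := by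
    have h := unitaryHeckeEigencharacterAdic_two_aeval c hc1 v w hw hv hT₁ X z
    rwa [aeval_X, eval_X] at h
  have hnz : unitaryHeckeEigencharacterAdic c hc1 v w hw hv ![-z, 1] T₁ = ((-z : ℂˣ) : ℂ) + (((-z : ℂˣ) : ℂ))⁻¹ := by
    have h := unitaryHeckeEigencharacterAdic_two_aeval c hc1 v w hw hv hT₁ X (-z)
    rwa [aeval_X, eval_X] at h
  have hneg : unitaryHeckeEigencharacterAdic c hc1 v w hw hv ![z, 1] ((-1 : ℂ) • T₁) =
      (-1 : ℂ) • unitaryHeckeEigencharacterAdic c hc1 v w hw hv ![z, 1] T₁ :=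
    (unitaryHeckeEigencharacterAdic c hc1 v w hw hv ![z, 1]).toLinearMap.map_smul (-1 : ℂ) T₁
  -- term-mode chain (no `rw` across the two sides: `(-1) • T₁ =?= T₁` on this function carrier is a heartbeat sink)
  have hC : (-1 : ℂ) • ((z : ℂ) + (z : ℂ)⁻¹) = ((-z : ℂˣ) : ℂ) + (((-z : ℂˣ) : ℂ))⁻¹ := by
    rw [Units.val_neg, inv_neg, smul_eq_mul]
    ring
  exact hneg.trans (((congrArg ((-1 : ℂ) • ·) hz).trans hC).trans hnz.symm)

/-! ## §3 (I.2) `η̂₁ = τ ∘ ξ̂_H ∘ ψ̂_G` -/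

section Factorisation

variable {K : Type u} [Field K] [ValuativeRel K] [IsDiscreteValuationRing 𝒪[K]] [Finite 𝓀[K]] {ϖ : K}
  [IsHeckeTriple (⊤ : Submonoid (GL (Fin 3) K)) (glInt 3 K) (glInt 3 K)]
  (hϖ : IsUniformizingElement ϖ) {u : ℂˣ} (hu : (u : ℂ) ^ 2 = ((Nat.card 𝓀[K] : ℕ) : ℂ))
  {wt : Multiplicative (Fin 3 → ℤ) →* ℂ}
  (hwt : ∀ e : Fin 3 → ℤ, wt (Multiplicative.ofAdd e) = ((u ^ ((((3 : ℕ) : ℤ) - 1) * (∑ i, e i) - 2 * satakeTwistExp e) : ℂˣ) : ℂ))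

/-- **(I.2) pointwise: `η̂₁ φ = τ (ξ̂_H (ψ̂_G φ))`** — the three ★ graphs compose to `η̂₁`'s: `λ^{U(2)}_{(z,1)}(τ ξ̂_H b φ) = λ^{U(2)}_{(−z,1)}(ξ̂_H b φ) =
`λ^{U(3)}_{(z,1,1)}(b φ) = λ^{GL₃}_{(z,1,z⁻¹)}(φ)`, and ★ `eq_etaOneGraphPartnerAlgHom_of_graph`. [cite: Rogawski1990, §4.7 p. 48; §4.9 p. 55; §4.10 Prop. 4.10.2 p. 58] -/
theorem etaOneGraphPartnerAlgHom_apply_eq_signInvolution (φ : heckeAlgebra ℂ (GL (Fin 3) K) (glInt 3 K)) :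
    etaOneGraphPartnerAlgHom c hc1 v w hw hv hϖ hu hwt φ =
      signInvolutionAlgHom c hc1 v w hw hv (satakeGraphPartnerAlgHom c hc1 v w hw hv (bcGraphPartnerAlgHom c hc1 v w hw hv hϖ hu hwt φ)) := by
  refine (eq_etaOneGraphPartnerAlgHom_of_graph c hc1 v w hw hv hϖ hu hwt φ _ fun z => ?_).symm
  rw [graph_signInvolutionAlgHom, graph_satakeGraphPartnerAlgHom, neg_neg]
  exact graph_bcGraphPartnerAlgHom c hc1 v w hw hv hϖ hu hwt φ z

/-- **(I.2) `η̂₁ = τ ∘ ξ̂_H ∘ ψ̂_G`** as `ℂ`-algebra homomorphisms `ℋ(GL₃(K), GL₃(𝒪)) →ₐ[ℂ] ℋ(U(J₀,2)(E_w), K₀)` (dealer ruling R2: the unsigned `η̂₁` and the signed `ξ̂_H`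
differ by the sign involution). [cite: Rogawski1990, §4.7 p. 48; §4.9 p. 55; §4.10 Prop. 4.10.1–4.10.2 pp. 57–58] -/
theorem etaOneGraphPartnerAlgHom_eq_signInvolution_comp :
    etaOneGraphPartnerAlgHom c hc1 v w hw hv hϖ hu hwt =
      (signInvolutionAlgHom c hc1 v w hw hv).comp
        ((satakeGraphPartnerAlgHom c hc1 v w hw hv).comp (bcGraphPartnerAlgHom c hc1 v w hw hv hϖ hu hwt)) :=
  AlgHom.ext fun φ => etaOneGraphPartnerAlgHom_apply_eq_signInvolution c hc1 v w hw hv hϖ hu hwt φ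

end Factorisation

/-! ## §4 (I.3, `k = 1`) `τ` on the basic operator -/

/-- **(I.3, `k = 1`) `τ φ′₁ = −φ′₁ + 2(√Q − 1)•1`** (stated with `(−1 : ℂ) • φ′₁`, scalar action only) for the basic operator `φ′₁ = 1_{K₀ t K₀}`, `t = diag(ϖ′, ϖ′⁻¹)` (★ `heckeEigencharacter_doubleCosetOperator_basic_two`:
`λ_{(z,1)}(φ′₁) = √Q(z + z⁻¹) + √Q − 1`, `√Q = Nat.sqrt #𝓀[E_w]`, read at `w` through any unramified datum `hd` by ★ `unitaryHeckeEigencharacterAdic_eq`): `λ_{(−z,1)}(φ′₁) =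
−√Q(z + z⁻¹) + √Q − 1 = −λ_{(z,1)}(φ′₁) + 2(√Q − 1)`. [cite: Rogawski1990, §4.9 p. 55] [cite: CartierCorvallis1979, §IV (4.2), Cor. 4.2] -/
theorem signInvolutionAlgHom_basic {ϖ' : w.1.adicCompletion E}
    (hd : UnramifiedLocalConjDatum (galAdicCompletionMap (L := E) c hw) ϖ') :
    haveI := isHeckeTriple_unitaryInt_adicCompletion c v w hw ((StdForm.antidiagonal 2).over (w.1.adicCompletion E))
    signInvolutionAlgHom c hc1 v w hw hv
        (heckeAlgebra.doubleCosetOperator (k := ℂ)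
          (unitaryInt (galAdicCompletionMap (L := E) c hw) ((StdForm.antidiagonal 2).over (w.1.adicCompletion E)))
          (⟨zpowDiagGL (uniformizer_ne_zero hd.vϖ) (fun i : Fin 2 => (1 : ℤ) * (1 - 2 * (i : ℕ))),
            zpowDiagGL_mem_unitaryGroupOfForm hd.σϖ _ (rev_linear_two 1)⟩ :
            ↥(unitaryGroupOfForm (galAdicCompletionMap (L := E) c hw) ((StdForm.antidiagonal 2).over (w.1.adicCompletion E))))) =
      (-1 : ℂ) • heckeAlgebra.doubleCosetOperator (k := ℂ)
          (unitaryInt (galAdicCompletionMap (L := E) c hw) ((StdForm.antidiagonal 2).over (w.1.adicCompletion E)))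
          (⟨zpowDiagGL (uniformizer_ne_zero hd.vϖ) (fun i : Fin 2 => (1 : ℤ) * (1 - 2 * (i : ℕ))),
            zpowDiagGL_mem_unitaryGroupOfForm hd.σϖ _ (rev_linear_two 1)⟩ :
            ↥(unitaryGroupOfForm (galAdicCompletionMap (L := E) c hw) ((StdForm.antidiagonal 2).over (w.1.adicCompletion E)))) +
        (2 * ((Nat.sqrt (Nat.card (Valued.ResidueField (w.1.adicCompletion E))) : ℂ) - 1)) • 1 := by
  haveI := isHeckeTriple_unitaryInt_adicCompletion c v w hw ((StdForm.antidiagonal 2).over (w.1.adicCompletion E))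
  haveI := finite_residueField_adicCompletion E w.1
  refine (eq_signInvolutionAlgHom_of_graph c hc1 v w hw hv _ _ fun z => ?_).symm
  -- the basic eigenvalue at `(z,1)` and at `(−z,1)`
  have hφ : ∀ y : ℂˣ, unitaryHeckeEigencharacterAdic c hc1 v w hw hv ![y, 1]
      (heckeAlgebra.doubleCosetOperator (k := ℂ)
        (unitaryInt (galAdicCompletionMap (L := E) c hw) ((StdForm.antidiagonal 2).over (w.1.adicCompletion E)))
        (⟨zpowDiagGL (uniformizer_ne_zero hd.vϖ) (fun i : Fin 2 => (1 : ℤ) * (1 - 2 * (i : ℕ))),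
          zpowDiagGL_mem_unitaryGroupOfForm hd.σϖ _ (rev_linear_two 1)⟩ :
          ↥(unitaryGroupOfForm (galAdicCompletionMap (L := E) c hw) ((StdForm.antidiagonal 2).over (w.1.adicCompletion E))))) =
      (Nat.sqrt (Nat.card (Valued.ResidueField (w.1.adicCompletion E))) : ℂ) * ((y : ℂ) + (y : ℂ)⁻¹) +
        ((Nat.sqrt (Nat.card (Valued.ResidueField (w.1.adicCompletion E))) : ℂ) - 1) := by
    intro y
    have h := (DFunLike.congr_fun (unitaryHeckeEigencharacterAdic_eq c hc1 v w hw hv hd ![y, 1]) _).trans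
      (hd.heckeEigencharacter_doubleCosetOperator_basic_two (exists_galAdicCompletionMap_ne c hc1 v w hw) ![y, 1])
    have hy : (((![y, 1] : Fin 2 → ℂˣ) 0 : ℂˣ) : ℂ) * ((((![y, 1] : Fin 2 → ℂˣ) 1 : ℂˣ) : ℂ))⁻¹ = y := by simp
    rw [hy] at h
    exact h
  have hs := fun (r : ℂ) x => (unitaryHeckeEigencharacterAdic c hc1 v w hw hv ![z, 1]).toLinearMap.map_smul r x
  have hone := (unitaryHeckeEigencharacterAdic c hc1 v w hw hv ![z, 1]).toRingHom.map_one
  refine (((unitaryHeckeEigencharacterAdic c hc1 v w hw hv ![z, 1]).toRingHom.map_add _ _).trans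
    ((congrArg₂ (· + ·) ((hs _ _).trans (congrArg (_ • ·) (hφ z))) ((hs _ 1).trans (congrArg (_ • ·) hone))).trans ?_))
  rw [hφ (-z), smul_eq_mul, smul_eq_mul, Units.val_neg, inv_neg]
  ring

end Sign

end Summit.HodgeConjecture.HodgeConjecture.R90.S6

end
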